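import Summits.HodgeConjecture.CorCM.MultiFieldWeilSurfaceBlockClosures
import Summits.HodgeConjecture.CorCM.CMAbelianFourfoldPowers
import HarnessLib

/-!
# MULTI-FIELD WEIL ENGINE — ON THE VARIETY: a complex abelian variety of CM type whose simple isogeny factors have dimension `≤ 3`, whose non-isogenous THREEFOLD factors are
# pairwise SEPARATED (different Galois closures of their CM fields, no common imaginary quadratic subfield) and whose SURFACE factors contain no dihedral triple, satisfies
# the Hodge conjecture together with everything dominated by its powers — given ONLY Markman's fourfold theorem

Cell `pub-hodgecm2` (COR-CM), seat b30 gen 35 (2026-08-25); count-neutral own lane MULTI-FIELD WEIL ENGINE (stem `MultiFieldWeil*`) — the INTRINSIC form of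
`CorCM/MultiFieldWeilSurfaceBlockClosures.lean` §3 with `b = id` (every threefold its own block), read on the variety through Milne's regrouping
(`exists_isIsogeny_biproduct_of_isSimple_of_isOfCMType`, seat b16).  Theorems only; no definition, no named fact, no `sorry`.  HONEST FRAMING: conditional on the displayed
Markman fourfold binder only; `HC_CM` is NOT proved and not asserted — a statement about a NAMED CLASS of CM abelian varieties (ANY NUMBER of non-elliptic factors).

THE STATEMENT (**`hodgeConjectureFor_of_avDominatedBy_powSucc_of_isOfCMType_of_separated_threefold_factors_of_markman`**).  Let `X` be a complex abelian variety of CM type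
such that (a) every simple isogeny factor has dimension `≤ 3`; (b) any two NON-isogenous simple isogeny factors `B₀, B₁` of dimension `3` are SEPARATED: for all CM
realisations `B₀ ⊨ (K₀; Φ₀)`, `B₁ ⊨ (K₁; Φ₁)` the Galois closures of `K₀`, `K₁` in `ℂ` differ and no totally complex quadratic subfield of `K₀` embeds in `K₁` (the
hypothesis is stated for ALL realisations so that nothing about the uniqueness of the CM field is used; for `K₀ = k·F`, `K₁ = k′·F′`: `k ≄ k′` and `k·L_F ≠ k′·L_{F′}`);
(c) no three pairwise non-isogenous simple isogeny factors of dimension `2` have CM realisations whose three fields share one Galois closure (no dihedral triple).  Then EVERY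
complex abelian variety dominated by a power `X^{N+1}` satisfies the Hodge conjecture, GIVEN ONLY `Markman2025_weilClasses_algebraic_abelianFourfold`.  In words: **up to
isogeny `X = ∏ E_e^{n_e} × ∏ S_s^{m_s} × ∏ T_t^{a_t}` with ANY CM elliptic curves, simple CM surfaces without a dihedral triple, and ANY NUMBER of pairwise separated simple
CM threefolds.**  (Pairs of non-separated threefolds: `CorCM/MultiFieldWeilAtMostTwoThreefoldTwoSurfaceFactors.lean`; cubic towers: gen 33–34.)

PROOF.  Milne's regrouping `X ∼ ⨁_i A'_{cls i}` (simple, pairwise non-isogenous, CM-realised, one index type); (b) on the realisations of the sextic slots is the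
separation hypothesis with `b = id`, (c) is (iii′); `hodgeConjectureFor_of_avDominatedBy_prod_of_separatedThreefoldPairs_of_closures_of_markman` applies to the product of
copies dominating `X^{N+1}` (`exists_avDominatedBy_powSucc_biproduct_slots`).

[cite: MoonenZarhin1999LowDim, Thm. (0.1), Thm. (0.2), §3 (3.1), Cor. (3.9), §5 (5.2)] [cite: Markman2025SurveySecant, Thm. 1.2] [cite: Milne1999LefschetzClasses, §1 Prop. 1.1]
[cite: MumfordAV1970, §19 Thm. 1, Cor. 1–2 and p. 169] [cite: Gordon1999HodgeAVSurvey, §3 Theorem (proof), 7.4–7.7, 10.10]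

## References
* [MoonenZarhin1999LowDim] B. Moonen, Yu. Zarhin, Math. Ann. 315 (1999) 711–733.  [Markman2025SurveySecant] E. Markman, arXiv:2509.23403, Thm. 1.2.
  [Milne1999LefschetzClasses] J. S. Milne, *Lefschetz classes on abelian varieties*, Duke Math. J. 96 (1999), §1 Prop. 1.1.  [MumfordAV1970] D. Mumford, *Abelian
  Varieties*, §19.  [Gordon1999HodgeAVSurvey] B. B. Gordon, *A survey of the Hodge conjecture for abelian varieties*, §3, 7.4–7.7, 10.10.
-/

noncomputable section

open CategoryTheory CategoryTheory.Limits NumberField IntermediateField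

namespace Summit.HodgeConjecture.CorCM.MultiFieldWeil

open Literature.AlgebraicGeometry Literature.AlgebraicGeometry.Motives Literature.AlgebraicGeometry.HodgeTheory
open Literature.AlgebraicGeometry.Motives.AbelianVariety
open Literature.AlgebraicGeometry.ComplexMultiplication (IsCMTypeRealisation)
open Literature.AlgebraicTopology.SingularHomology
open Literature.NumberTheory.ComplexMultiplication
open Literature.AlgebraicGeometry.Milne1999 (IsOfCMType)
open Summit.HodgeConjecture.CorCM.Domination

open scoped Classical

section OnTheVariety

variable {X : AbelianVariety ℂ}

/-- Powers of a zero-dimensional abelian variety are zero-dimensional. [folklore] -/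
private theorem dim_powSucc_eq_zero₃₅s (h0 : X.dim = 0) : ∀ N : ℕ, (X.powSucc N).dim = 0
  | 0 => h0
  | N + 1 => by rw [powSucc_succ, dim_prod, dim_powSucc_eq_zero₃₅s h0 N, h0]

/-- **MAIN THEOREM (on the variety) — PAIRWISE SEPARATED THREEFOLD FACTORS, NO DIHEDRAL SURFACE TRIPLE, ANY ELLIPTIC FACTORS, given ONLY Markman's fourfold theorem.**
`X` of CM type; (a) simple isogeny factors of dimension `≤ 3`; (b) any two non-isogenous simple threefold factors separated for all CM realisations; (c) no three pairwise
non-isogenous simple surface factors with CM realisations sharing one Galois closure.  Then everything dominated by a power `X^{N+1}` satisfies the Hodge conjecture, GIVEN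
ONLY `Markman2025_weilClasses_algebraic_abelianFourfold`.  `HC_CM` is NOT asserted. [cite: Milne1999LefschetzClasses, §1 Prop. 1.1]
[cite: MoonenZarhin1999LowDim, Thm. (0.1), (0.2), §3 (3.1), Cor. (3.9)] [cite: Markman2025SurveySecant, Thm. 1.2] [cite: MumfordAV1970, §19 Thm. 1, Cor. 1–2] -/
theorem hodgeConjectureFor_of_avDominatedBy_powSucc_of_isOfCMType_of_separated_threefold_factors_of_markman
    (hW4 : Markman2025_weilClasses_algebraic_abelianFourfold) (hcm : IsOfCMType X)
    (h3 : ∀ B : AbelianVariety ℂ, B.IsSimple → AVDominatedBy B X → B.dim ≤ 3)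
    (hT : ∀ B₀ B₁ : AbelianVariety ℂ, B₀.IsSimple → B₁.IsSimple → AVDominatedBy B₀ X → AVDominatedBy B₁ X → B₀.dim = 3 → B₁.dim = 3 → ¬ IsIsogenous B₀ B₁ →
      ∀ (K₀ : Type) [Field K₀] [NumberField K₀] [IsCMField K₀] (Φ₀ : CMType K₀) (ι₀ : 𝓞 K₀ →+* End B₀) (θ₀ : K₀ →+* Module.End ℂ (complexBetti B₀.X 1))
        (K₁ : Type) [Field K₁] [NumberField K₁] [IsCMField K₁] (Φ₁ : CMType K₁) (ι₁ : 𝓞 K₁ →+* End B₁) (θ₁ : K₁ →+* Module.End ℂ (complexBetti B₁.X 1)),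
        IsCMTypeRealisation Φ₀ B₀ ι₀ θ₀ → IsCMTypeRealisation Φ₁ B₁ ι₁ θ₁ →
          normalClosure ℚ K₀ ℂ ≠ normalClosure ℚ K₁ ℂ ∧ ¬ ∃ F : IntermediateField ℚ K₀, Module.finrank ℚ F = 2 ∧ IsTotallyComplex F ∧ Nonempty (F →+* K₁))
    (hS : ∀ B₀ B₁ B₂ : AbelianVariety ℂ, B₀.IsSimple → B₁.IsSimple → B₂.IsSimple → AVDominatedBy B₀ X → AVDominatedBy B₁ X → AVDominatedBy B₂ X →
      B₀.dim = 2 → B₁.dim = 2 → B₂.dim = 2 → ¬ IsIsogenous B₀ B₁ → ¬ IsIsogenous B₀ B₂ → ¬ IsIsogenous B₁ B₂ →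
      ∀ (K₀ : Type) [Field K₀] [NumberField K₀] [IsCMField K₀] (Φ₀ : CMType K₀) (ι₀ : 𝓞 K₀ →+* End B₀) (θ₀ : K₀ →+* Module.End ℂ (complexBetti B₀.X 1))
        (K₁ : Type) [Field K₁] [NumberField K₁] [IsCMField K₁] (Φ₁ : CMType K₁) (ι₁ : 𝓞 K₁ →+* End B₁) (θ₁ : K₁ →+* Module.End ℂ (complexBetti B₁.X 1))
        (K₂ : Type) [Field K₂] [NumberField K₂] [IsCMField K₂] (Φ₂ : CMType K₂) (ι₂ : 𝓞 K₂ →+* End B₂) (θ₂ : K₂ →+* Module.End ℂ (complexBetti B₂.X 1)),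
        IsCMTypeRealisation Φ₀ B₀ ι₀ θ₀ → IsCMTypeRealisation Φ₁ B₁ ι₁ θ₁ → IsCMTypeRealisation Φ₂ B₂ ι₂ θ₂ →
          ¬ (normalClosure ℚ K₀ ℂ = normalClosure ℚ K₁ ℂ ∧ normalClosure ℚ K₁ ℂ = normalClosure ℚ K₂ ℂ))
    {B : AbelianVariety ℂ} {N : ℕ} (hB : AVDominatedBy B (X.powSucc N)) : HodgeConjectureFor B.dim B.X := by
  rcases Nat.eq_zero_or_pos X.dim with h0 | hX0
  · exact hodgeConjectureFor_of_isDivisorGenerated _ (isDivisorGenerated_of_avDominatedBy hB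
      (Literature.AlgebraicGeometry.Pohlmann1968.isDivisorGenerated_of_dim_eq_zero _ (dim_powSucc_eq_zero₃₅s h0 N)))
  -- Milne's regrouping: `X ∼ ⨁_i A'_{cls i}`, `A'_c` simple, pairwise non-isogenous, CM-realised
  obtain ⟨C, _, K', _, _, _, Φ', A', ι', θ', m, cls, f, hA, hs, hniso, hcls, hf⟩ := exists_isIsogeny_biproduct_of_isSimple_of_isOfCMType (X := X) hX0 hcm
  have hXP : AVDominatedBy X (⨁ fun i => A' (cls i)) := AVDominatedBy.of_isIsogeny_hom hf (AVDominatedBy.refl _)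
  have hPX : AVDominatedBy (⨁ fun i => A' (cls i)) X := AVDominatedBy.of_isIsogeny_inv hf (AVDominatedBy.refl _)
  have hslot : ∀ c, AVDominatedBy (A' c) X := fun c => by
    obtain ⟨i, rfl⟩ := hcls c
    exact (avDominatedBy_biproduct_summand (fun i => A' (cls i)) i).trans hPX
  have hdim3 : ∀ c, (A' c).dim ≤ 3 := fun c => h3 _ (hs c) (hslot c)
  have hfin : ∀ c, Module.finrank ℚ (K' c) = 2 * (A' c).dim := fun c =>
    Literature.AlgebraicGeometry.Pohlmann1968.finrank_eq_two_mul_dim_of_isCMTypeRealisation (hA c)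
  -- (b) on the sextic slots, `b = id`
  have hsep : ∀ t t', Module.finrank ℚ (K' t) = 6 → Module.finrank ℚ (K' t') = 6 → t ≠ t' →
      normalClosure ℚ (K' t) ℂ ≠ normalClosure ℚ (K' t') ℂ ∧
        ¬ ∃ F : IntermediateField ℚ (K' t), Module.finrank ℚ F = 2 ∧ IsTotallyComplex F ∧ Nonempty (F →+* K' t') := fun t t' ht ht' hne =>
    hT (A' t) (A' t') (hs t) (hs t') (hslot t) (hslot t') (by have := hfin t; omega) (by have := hfin t'; omega) (hniso t t' hne)
      (K' t) (Φ' t) (ι' t) (θ' t) (K' t') (Φ' t') (ι' t') (θ' t') (hA t) (hA t')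
  -- (c) on the quartic slots
  have hS3 : ∀ i j l : C, Module.finrank ℚ (K' i) = 4 → Module.finrank ℚ (K' j) = 4 → Module.finrank ℚ (K' l) = 4 →
      normalClosure ℚ (K' i) ℂ = normalClosure ℚ (K' j) ℂ → normalClosure ℚ (K' j) ℂ = normalClosure ℚ (K' l) ℂ →
      IsIsogenous (A' i) (A' j) ∨ IsIsogenous (A' i) (A' l) ∨ IsIsogenous (A' j) (A' l) := by
    intro i j l hi hj hl hLij hLjl
    by_cases hij : i = j
    · subst hij
      exact Or.inl (IsIsogenous.refl _)
    by_cases hil : i = l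
    · subst hil
      exact Or.inr (Or.inl (IsIsogenous.refl _))
    by_cases hjl : j = l
    · subst hjl
      exact Or.inr (Or.inr (IsIsogenous.refl _))
    exact absurd ⟨hLij, hLjl⟩ (hS (A' i) (A' j) (A' l) (hs i) (hs j) (hs l) (hslot i) (hslot j) (hslot l) (by have := hfin i; omega)
      (by have := hfin j; omega) (by have := hfin l; omega) (hniso i j hij) (hniso i l hil) (hniso j l hjl)
      (K' i) (Φ' i) (ι' i) (θ' i) (K' j) (Φ' j) (ι' j) (θ' j) (K' l) (Φ' l) (ι' l) (θ' l) (hA i) (hA j) (hA l))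
  -- every power of `X` is dominated by a product of copies of the slots
  obtain ⟨n, π, hdom⟩ := exists_avDominatedBy_powSucc_biproduct_slots A' cls hXP N
  exact hodgeConjectureFor_of_avDominatedBy_prod_of_separatedThreefoldPairs_of_closures_of_markman (C := C) hW4 hA hs hdim3 id hsep
    (fun _ _ _ _ _ _ h _ => Or.inl h) hS3 π (hB.trans hdom)

/-- **The Hodge conjecture for `X` itself and all its powers**, under (a)–(c), given only Markman's fourfold theorem. [cite: MoonenZarhin1999LowDim, Thm. (0.1), (0.2)]
[cite: Markman2025SurveySecant, Thm. 1.2] -/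
theorem hodgeConjectureFor_powSucc_of_isOfCMType_of_separated_threefold_factors_of_markman (hW4 : Markman2025_weilClasses_algebraic_abelianFourfold)
    (hcm : IsOfCMType X) (h3 : ∀ B : AbelianVariety ℂ, B.IsSimple → AVDominatedBy B X → B.dim ≤ 3)
    (hT : ∀ B₀ B₁ : AbelianVariety ℂ, B₀.IsSimple → B₁.IsSimple → AVDominatedBy B₀ X → AVDominatedBy B₁ X → B₀.dim = 3 → B₁.dim = 3 → ¬ IsIsogenous B₀ B₁ →
      ∀ (K₀ : Type) [Field K₀] [NumberField K₀] [IsCMField K₀] (Φ₀ : CMType K₀) (ι₀ : 𝓞 K₀ →+* End B₀) (θ₀ : K₀ →+* Module.End ℂ (complexBetti B₀.X 1))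
        (K₁ : Type) [Field K₁] [NumberField K₁] [IsCMField K₁] (Φ₁ : CMType K₁) (ι₁ : 𝓞 K₁ →+* End B₁) (θ₁ : K₁ →+* Module.End ℂ (complexBetti B₁.X 1)),
        IsCMTypeRealisation Φ₀ B₀ ι₀ θ₀ → IsCMTypeRealisation Φ₁ B₁ ι₁ θ₁ →
          normalClosure ℚ K₀ ℂ ≠ normalClosure ℚ K₁ ℂ ∧ ¬ ∃ F : IntermediateField ℚ K₀, Module.finrank ℚ F = 2 ∧ IsTotallyComplex F ∧ Nonempty (F →+* K₁))
    (hS : ∀ B₀ B₁ B₂ : AbelianVariety ℂ, B₀.IsSimple → B₁.IsSimple → B₂.IsSimple → AVDominatedBy B₀ X → AVDominatedBy B₁ X → AVDominatedBy B₂ X →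
      B₀.dim = 2 → B₁.dim = 2 → B₂.dim = 2 → ¬ IsIsogenous B₀ B₁ → ¬ IsIsogenous B₀ B₂ → ¬ IsIsogenous B₁ B₂ →
      ∀ (K₀ : Type) [Field K₀] [NumberField K₀] [IsCMField K₀] (Φ₀ : CMType K₀) (ι₀ : 𝓞 K₀ →+* End B₀) (θ₀ : K₀ →+* Module.End ℂ (complexBetti B₀.X 1))
        (K₁ : Type) [Field K₁] [NumberField K₁] [IsCMField K₁] (Φ₁ : CMType K₁) (ι₁ : 𝓞 K₁ →+* End B₁) (θ₁ : K₁ →+* Module.End ℂ (complexBetti B₁.X 1))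
        (K₂ : Type) [Field K₂] [NumberField K₂] [IsCMField K₂] (Φ₂ : CMType K₂) (ι₂ : 𝓞 K₂ →+* End B₂) (θ₂ : K₂ →+* Module.End ℂ (complexBetti B₂.X 1)),
        IsCMTypeRealisation Φ₀ B₀ ι₀ θ₀ → IsCMTypeRealisation Φ₁ B₁ ι₁ θ₁ → IsCMTypeRealisation Φ₂ B₂ ι₂ θ₂ →
          ¬ (normalClosure ℚ K₀ ℂ = normalClosure ℚ K₁ ℂ ∧ normalClosure ℚ K₁ ℂ = normalClosure ℚ K₂ ℂ))
    (N : ℕ) : HodgeConjectureFor (X.powSucc N).dim (X.powSucc N).X :=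
  hodgeConjectureFor_of_avDominatedBy_powSucc_of_isOfCMType_of_separated_threefold_factors_of_markman hW4 hcm h3 hT hS (AVDominatedBy.refl _)

/-- **ON THE VARIETY — AT MOST TWO THREEFOLD CLASSES, NO DIHEDRAL SURFACE TRIPLE, ANY ELLIPTIC FACTORS, given ONLY Markman's fourfold theorem.**  `X` of CM type; (a) simple
isogeny factors of dimension `≤ 3`; (b′) among any three simple threefold factors two are isogenous; (c) no three pairwise non-isogenous simple surface factors with CM
realisations sharing one Galois closure.  Then everything dominated by a power `X^{N+1}` satisfies the Hodge conjecture (sharpens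
`CorCM/MultiFieldWeilAtMostTwoThreefoldTwoSurfaceFactors.lean`: «at most two surface classes» ⟹ (c)).  `HC_CM` is NOT asserted. [cite: Milne1999LefschetzClasses, §1 Prop. 1.1]
[cite: MoonenZarhin1999LowDim, Thm. (0.1), (0.2), §3 (3.1), Cor. (3.9)] [cite: Markman2025SurveySecant, Thm. 1.2] [cite: MumfordAV1970, §19 Thm. 1, Cor. 1–2] -/
theorem hodgeConjectureFor_of_avDominatedBy_powSucc_of_isOfCMType_of_atMostTwo_threefold_classes_noDihedralTriple_of_markman
    (hW4 : Markman2025_weilClasses_algebraic_abelianFourfold) (hcm : IsOfCMType X)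
    (h3 : ∀ B : AbelianVariety ℂ, B.IsSimple → AVDominatedBy B X → B.dim ≤ 3)
    (hT : ∀ B₀ B₁ B₂ : AbelianVariety ℂ, B₀.IsSimple → B₁.IsSimple → B₂.IsSimple → AVDominatedBy B₀ X → AVDominatedBy B₁ X → AVDominatedBy B₂ X →
      B₀.dim = 3 → B₁.dim = 3 → B₂.dim = 3 → IsIsogenous B₀ B₁ ∨ IsIsogenous B₀ B₂ ∨ IsIsogenous B₁ B₂)
    (hS : ∀ B₀ B₁ B₂ : AbelianVariety ℂ, B₀.IsSimple → B₁.IsSimple → B₂.IsSimple → AVDominatedBy B₀ X → AVDominatedBy B₁ X → AVDominatedBy B₂ X →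
      B₀.dim = 2 → B₁.dim = 2 → B₂.dim = 2 → ¬ IsIsogenous B₀ B₁ → ¬ IsIsogenous B₀ B₂ → ¬ IsIsogenous B₁ B₂ →
      ∀ (K₀ : Type) [Field K₀] [NumberField K₀] [IsCMField K₀] (Φ₀ : CMType K₀) (ι₀ : 𝓞 K₀ →+* End B₀) (θ₀ : K₀ →+* Module.End ℂ (complexBetti B₀.X 1))
        (K₁ : Type) [Field K₁] [NumberField K₁] [IsCMField K₁] (Φ₁ : CMType K₁) (ι₁ : 𝓞 K₁ →+* End B₁) (θ₁ : K₁ →+* Module.End ℂ (complexBetti B₁.X 1))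
        (K₂ : Type) [Field K₂] [NumberField K₂] [IsCMField K₂] (Φ₂ : CMType K₂) (ι₂ : 𝓞 K₂ →+* End B₂) (θ₂ : K₂ →+* Module.End ℂ (complexBetti B₂.X 1)),
        IsCMTypeRealisation Φ₀ B₀ ι₀ θ₀ → IsCMTypeRealisation Φ₁ B₁ ι₁ θ₁ → IsCMTypeRealisation Φ₂ B₂ ι₂ θ₂ →
          ¬ (normalClosure ℚ K₀ ℂ = normalClosure ℚ K₁ ℂ ∧ normalClosure ℚ K₁ ℂ = normalClosure ℚ K₂ ℂ))
    {B : AbelianVariety ℂ} {N : ℕ} (hB : AVDominatedBy B (X.powSucc N)) : HodgeConjectureFor B.dim B.X := by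
  rcases Nat.eq_zero_or_pos X.dim with h0 | hX0
  · exact hodgeConjectureFor_of_isDivisorGenerated _ (isDivisorGenerated_of_avDominatedBy hB
      (Literature.AlgebraicGeometry.Pohlmann1968.isDivisorGenerated_of_dim_eq_zero _ (dim_powSucc_eq_zero₃₅s h0 N)))
  obtain ⟨C, _, K', _, _, _, Φ', A', ι', θ', m, cls, f, hA, hs, hniso, hcls, hf⟩ := exists_isIsogeny_biproduct_of_isSimple_of_isOfCMType (X := X) hX0 hcm
  have hXP : AVDominatedBy X (⨁ fun i => A' (cls i)) := AVDominatedBy.of_isIsogeny_hom hf (AVDominatedBy.refl _)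
  have hPX : AVDominatedBy (⨁ fun i => A' (cls i)) X := AVDominatedBy.of_isIsogeny_inv hf (AVDominatedBy.refl _)
  have hslot : ∀ c, AVDominatedBy (A' c) X := fun c => by
    obtain ⟨i, rfl⟩ := hcls c
    exact (avDominatedBy_biproduct_summand (fun i => A' (cls i)) i).trans hPX
  have hdim3 : ∀ c, (A' c).dim ≤ 3 := fun c => h3 _ (hs c) (hslot c)
  have hfin : ∀ c, Module.finrank ℚ (K' c) = 2 * (A' c).dim := fun c =>
    Literature.AlgebraicGeometry.Pohlmann1968.finrank_eq_two_mul_dim_of_isCMTypeRealisation (hA c)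
  have heq : ∀ c c', IsIsogenous (A' c) (A' c') → c = c' := fun c c' h => by
    by_contra hne
    exact hniso c c' hne h
  have hT2 : ∀ c c' c'' : C, Module.finrank ℚ (K' c) = 6 → Module.finrank ℚ (K' c') = 6 → Module.finrank ℚ (K' c'') = 6 → c = c' ∨ c = c'' ∨ c' = c'' := by
    intro c c' c'' h h' h''
    rcases hT (A' c) (A' c') (A' c'') (hs c) (hs c') (hs c'') (hslot c) (hslot c') (hslot c'') (by have := hfin c; omega) (by have := hfin c'; omega)
        (by have := hfin c''; omega) with hi | hi | hi
    · exact Or.inl (heq _ _ hi)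
    · exact Or.inr (Or.inl (heq _ _ hi))
    · exact Or.inr (Or.inr (heq _ _ hi))
  have hS3 : ∀ i j l : C, Module.finrank ℚ (K' i) = 4 → Module.finrank ℚ (K' j) = 4 → Module.finrank ℚ (K' l) = 4 →
      normalClosure ℚ (K' i) ℂ = normalClosure ℚ (K' j) ℂ → normalClosure ℚ (K' j) ℂ = normalClosure ℚ (K' l) ℂ →
      IsIsogenous (A' i) (A' j) ∨ IsIsogenous (A' i) (A' l) ∨ IsIsogenous (A' j) (A' l) := by
    intro i j l hi hj hl hLij hLjl
    by_cases hij : i = j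
    · subst hij
      exact Or.inl (IsIsogenous.refl _)
    by_cases hil : i = l
    · subst hil
      exact Or.inr (Or.inl (IsIsogenous.refl _))
    by_cases hjl : j = l
    · subst hjl
      exact Or.inr (Or.inr (IsIsogenous.refl _))
    exact absurd ⟨hLij, hLjl⟩ (hS (A' i) (A' j) (A' l) (hs i) (hs j) (hs l) (hslot i) (hslot j) (hslot l) (by have := hfin i; omega)
      (by have := hfin j; omega) (by have := hfin l; omega) (hniso i j hij) (hniso i l hil) (hniso j l hjl)
      (K' i) (Φ' i) (ι' i) (θ' i) (K' j) (Φ' j) (ι' j) (θ' j) (K' l) (Φ' l) (ι' l) (θ' l) (hA i) (hA j) (hA l))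
  obtain ⟨n, π, hdom⟩ := exists_avDominatedBy_powSucc_biproduct_slots A' cls hXP N
  exact hodgeConjectureFor_of_avDominatedBy_prod_of_atMostTwo_threefolds_of_closures_of_markman hW4 hA hs hdim3 hT2 hS3 π (hB.trans hdom)

end OnTheVariety

end Summit.HodgeConjecture.CorCM.MultiFieldWeil

end
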